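import Literature.MathematicalPhysics.QuantumFieldTheory.Balaban1983to89.B9Thm37GlueTorusTwist

/-!
# `Balaban1983to89.B9Thm37GlueTorusCov` — the COVARIANT block mean Q(U) of the one-step averaging
# (parallel transport to the base point of the block BEFORE averaging) and the strict positivity of
# Δ_U + a·Q(U)ᵀQ(U) for EVERY unit transport U (MODEL; the positive counterpart of the barrier note
# `B9Thm37GlueTorusTwist`; own lineage pv21; imports `B9Thm37GlueTorusTwist` only; modifies nothing)

References (bib keys; the tags below cite only these):
* [B9] = `Balaban1985BackgroundPropagators` — T. Bałaban, *Propagators for lattice gauge theories in a background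
  field*, Commun. Math. Phys. 99 (1985) 389–434.
* [B7] = `Balaban1985Averaging` — T. Bałaban, *Averaging operations for lattice gauge theories*, Commun. Math. Phys.
  98 (1985) 17–51 (= reference [5] of [B9], there cited as the preprint HUTMP B147; CONTEXT only, nothing of it is
  quoted or asserted here).

THE PRINTED LOCUS (read as an image of the printed page, [B9] p. 393; the one NEW locus of this file).  After (3.17)
print defines the averaging operators acting on the (algebra-valued) functions λ: «(Q′λ)(y) = (Q′_j(U)λ)(y) for
y ∈ Λ_j,» (3.18), «(Q′(V)λ)(y) = Σ_{x∈B(y)} L^{−d} R(V(Γ_{y,x}))λ(x),» and «(Q′_j(U)λ)(y) = (Q′(Ū^{j−1})·…·Q′(Ū)Q′(U)λ)(y)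
= Σ_{x∈B^j(y)} L^{−jd} R(U(Γ^{(j)}_{y,x}))λ(x), y ∈ T^{(j)}_{L^jη}.» (3.19), followed by «The contours Γ^{(j)}_{y,x},
x ∈ B^j(y), and the contour variables U(Γ^{(j)}_{y,x}) were defined by (52), (53) in [5].»  Here R(·) is the rotation of
(3.3) pp. 390–391 (certified in the header of `B9Thm37Glue`, where it enters the covariant derivative `covD`), B(y) is
the block with base point y, Γ_{y,x} a contour from y to x inside the block, and V(Γ_{y,x}) the ordered product of the
bond variables along it.  The operator Δ′_a = Δ_U + Q′\*aQ′ of (3.23)–(3.24) p. 394 (certified in the header of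
`B9Thm37Glue`) is built from these Q′_j(U); p. 395 asserts its positivity "assuming some regularity of the
configuration U" (certified in `B9Thm37GlueTorusInv`).  Only the ONE-STEP operator Q′(V) of (3.18)–(3.19) is modelled
below; NOTHING printed is asserted as a theorem — every declaration of this file is a MODEL definition or a
kernel-checked theorem about the component model of the lineage.

THE POINT (value = a MODEL kernel certificate steering the lineage; NOT summit progress).  `B9Thm37GlueTorusTwist`
proved that the cheapest massless stand-in for Q′\*aQ′ — a U-INDEPENDENT componentwise (block) mean T — makes
Δ_U + a·T SINGULAR for a flat quarter-turn twist (`not_isUnit_twist`, `not_isUnit_twist8`), and recorded the moral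
that the averaging must SEE the transport, as print's Q′(V) does through R(V(Γ_{y,x})).  THIS FILE formalises that
covariant one-step mean over an ABSTRACT COMB and proves the positive statement in full generality:
 * §1 `Comb src tgt B` (MODEL bookkeeping): every site x carries a block label `blk x`, every block β a base point
   `base β`, and a rooted forest (`depth`, `parent`, parent bond `pbond x : parent x → x` of the given bond structure
   `src`/`tgt`) descends inside each block to its base point — the model of the contours Γ_{y,x}.  The TRANSPORT
   `K.tr Rm x` = the ordered product of the bond matrices Rm(b) (= R(U(b)) in components) along the comb path from the
   base point to x (defined by recursion on the depth), so that a covariantly constant f (∇_U f = `covD … f` = 0, all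
   bond weights c(b) ≠ 0) is REPRODUCED: Σ_j (K.tr Rm x)_{ij} f(x, j) = f(base, i) (`tr_reproduces`), and K.tr Rm x is an
   isometry (columns orthonormal, `tr_orth`) whenever every Rm(b) is (the lineage's binder `hRm`).
 * §2 the covariant mean `covMean K w Rm = bsum ∘ trOp` : (Q_U f)(β, i) = w(β)·Σ_{x : blk x = β} Σ_j (K.tr Rm x)_{ij} f(x, j)
   — the model of (3.19) with L^{−d} ↦ an arbitrary non-zero block weight w(β) — its explicit transpose `covMeanT`
   (`isTransposePair_covMean`), the operator `covLapCov K c w Rm a = D\*D + a·Q_UᵀQ_U` (the one-step model of Δ′_a),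
   its quadratic form Σ_b (∇_U f)(b)² + a·Σ (Q_U f)² (`qform_covLapCov`), and the main theorem `posDef_covLapCov`: for
   a > 0, w(β) ≠ 0, c(b) ≠ 0 and ISOMETRIC bond matrices (hRm) the operator Δ_U + a·Q_UᵀQ_U is STRICTLY POSITIVE —
   for EVERY transport, with NO flatness or small-curvature hypothesis — hence a unit with a genuine two-sided
   `Ring.inverse` (`isUnit_covLapCov`, `inverse_mul_covLapCov`, `mul_inverse_covLapCov`) and symmetric
   (`isTransposePair_covLapCov`).  Mechanism (`covMean_ne_zero`): if ∇_U f = 0 and f ≠ 0 then f is reproduced from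
   its value at a base point, which is non-zero by the isometry, so its covariant mean over that block is
   (number of sites of the block)·w(β)·f(base) ≠ 0 — exactly what fails for the U-independent mean of the twist.
 * §3 CONSTRUCTION (no existence smuggled into §1): on every torus `UT N` of the lineage with cubic blocks of side M₀,
   1 ≤ M₀, M₀ ∣ N_i (the standing regime of the chain), the lexicographic comb to the block corner M₀z (`ctrU`,
   the lineage's block centres) is a `Comb bsrc btgt (Ctr N M₀)` for the nearest-neighbour bonds of `B9Thm37GluePU`
   (`torusComb`): parent of x = x − e_μ for the first axis μ with non-zero offset x_μ mod M₀; hence Δ_U + a·Q_UᵀQ_U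
   is a unit on every such torus for every isometric transport (`isUnit_covLapCov_torus`).
 * §4 THE TWIST REVISITED: on the 4-point and 8-point circles of `B9Thm37GlueTorusTwist` (quarter-turn transport
   `Rm4`/`Rm8`, blocks of side 4) the covariantly constant twist fields `fw`, `fw8` — which KILLED the U-independent
   means — have NON-ZERO covariant mean (`covMean_fw_ne_zero`, `covMean_fw8_ne_zero`), and Δ_U + a·Q_UᵀQ_U IS a unit
   (`isUnit_cov_twist`, `isUnit_cov_twist8`), side by side with `not_isUnit_twist`, `not_isUnit_twist8`.

NOT ASSERTED, NOT MODELLED (honest scope).  Only the one-step (j = 0) covariant mean; not the multi-step Q′_j(U) of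
(3.19) (compositions through the averaged configurations Ū^j), not the algebra-valued/adjoint-representation setting
beyond "components with isometric bond matrices", not (3.16)–(3.17), not Theorems 3.1–3.3, Corollary 3.6 or Theorem
3.7 of [B9], and no decay or uniformity statement: positivity here is qualitative (a unit), the coercivity constant
and its dependence on (d, M₀, c, a, U) are NOT estimated (that, and the Combes–Thomas step for `covLapCov` on the
torus, are later nodes).  The capstones of the chain (`B9Thm37GlueTorusInv.thm37_entry1_l1_dir` …, `…TorusRW`,
`…TorusScaled`) are wired to the DIAGONAL mass M_q and do NOT consume `covLapCov`; in particular their locality lemma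
`mulOp_hSU_covLapQ_mulOp` has no analogue here yet (Q_UᵀQ_U has range M₀ inside a block, not 0).  Value = MODEL
kernel certificate, NOT summit progress; NOT continuum, NOT Clay, NOT a claim about print beyond the quoted locus.
-/

namespace Literature.MathematicalPhysics.QuantumFieldTheory.Balaban1983to89.B9Thm37GlueTorusCov

open Finset B9Thm37Sum B9Thm37Glue B9Thm37GluePU B9Thm37GlueTorusInv B9Thm37GlueTorusTwist
open B5TorusCover (UT Ctr ctrU ctr nC)
open B5Leibniz121 (up dn up_dn)

noncomputable section

/-! ## §1  Abstract combs and the parallel transport to the base point -/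

section CombDef

variable {St Bd : Type}

/-- MODEL bookkeeping (the contours Γ_{y,x} of (3.19) as a rooted forest): a COMB for the bond structure
`src`, `tgt` with block labels in `B` — every site has a block `blk x`, every block a base point `base β`, and every
site of positive `depth` a `parent` in the same block, one level up, joined to it by the bond `pbond x : parent x → x`;
depth-zero sites are the base points of their blocks. [cite: Balaban1985BackgroundPropagators, (3.19) p.393] -/
structure Comb (src tgt : Bd → St) (B : Type) where
  /-- the block label of a site -/
  blk : St → B
  /-- the base point of a block -/
  base : B → St
  /-- the number of comb steps from the base point -/
  depth : St → ℕ
  /-- the predecessor on the comb path (irrelevant at depth 0) -/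
  parent : St → St
  /-- the bond from the predecessor (irrelevant at depth 0) -/
  pbond : St → Bd
  /-- depth-zero sites are base points -/
  eq_base : ∀ x, depth x = 0 → x = base (blk x)
  /-- the parent bond starts at the parent -/
  src_pbond : ∀ x, depth x ≠ 0 → src (pbond x) = parent x
  /-- the parent bond ends at the site -/
  tgt_pbond : ∀ x, depth x ≠ 0 → tgt (pbond x) = x
  /-- the parent is one level up -/
  depth_parent : ∀ x, depth x ≠ 0 → depth (parent x) + 1 = depth x
  /-- the parent lies in the same block -/
  blk_parent : ∀ x, depth x ≠ 0 → blk (parent x) = blk x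

end CombDef

namespace Comb

variable {St Bd B Cp : Type} [Fintype Cp] [DecidableEq Cp] {src tgt : Bd → St} (K : Comb src tgt B)
  (Rm : Bd → Cp → Cp → ℝ)

/-- The transport matrix by fuel recursion (MODEL bookkeeping; `tr` below takes fuel = depth). [folklore] -/
def trAux : ℕ → St → Cp → Cp → ℝ
  | 0 => fun _ i j => if i = j then 1 else 0
  | n + 1 => fun x i j => if K.depth x = 0 then (if i = j then 1 else 0)
      else ∑ k, trAux n (K.parent x) i k * Rm (K.pbond x) k j

/-- **The parallel transport to the base point** (MODEL of R(V(Γ_{y,x})) in (3.19)): the ordered product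
Rm(b₁)Rm(b₂)⋯Rm(bₙ) of the bond matrices along the comb path base = x₀ → x₁ → ⋯ → xₙ = x, bₖ = `pbond xₖ`, so that
for a covariantly constant f one has f(x₀) = (tr x)f(x). [cite: Balaban1985BackgroundPropagators, (3.19) p.393] -/
def tr (x : St) : Cp → Cp → ℝ := K.trAux Rm (K.depth x) x

/-- At a base point the transport is the identity matrix. [folklore] -/
theorem tr_of_depth_eq_zero {x : St} (hx : K.depth x = 0) (i j : Cp) :
    K.tr Rm x i j = if i = j then 1 else 0 := by
  unfold tr
  rw [hx]
  rfl

/-- The recursion: tr x = (tr (parent x))·Rm(pbond x) at positive depth. [folklore] -/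
theorem tr_of_depth_ne_zero {x : St} (hx : K.depth x ≠ 0) (i j : Cp) :
    K.tr Rm x i j = ∑ k, K.tr Rm (K.parent x) i k * Rm (K.pbond x) k j := by
  obtain ⟨n, hn⟩ := Nat.exists_eq_succ_of_ne_zero hx
  have hp : K.depth (K.parent x) = n := by
    have := K.depth_parent x hx
    omega
  unfold tr
  rw [hn, hp]
  show (if K.depth x = 0 then (if i = j then (1 : ℝ) else 0)
      else ∑ k, K.trAux Rm n (K.parent x) i k * Rm (K.pbond x) k j) = _
  rw [if_neg hx]

/-- **The transport is an isometry** (columns orthonormal: (tr x)ᵀ(tr x) = 1) whenever every bond matrix is — the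
lineage's binder `hRm`. [folklore] -/
theorem tr_orth (hRm : ∀ b i j, ∑ k, Rm b k i * Rm b k j = if i = j then (1 : ℝ) else 0) :
    ∀ x i j, ∑ k, K.tr Rm x k i * K.tr Rm x k j = if i = j then (1 : ℝ) else 0 := by
  suffices h : ∀ n x, K.depth x = n → ∀ i j, ∑ k, K.tr Rm x k i * K.tr Rm x k j = if i = j then (1 : ℝ) else 0 from
    fun x => h _ x rfl
  intro n
  induction n with
  | zero =>
      intro x hx i j
      simp_rw [K.tr_of_depth_eq_zero Rm hx]
      by_cases hij : i = j
      · subst hij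
        simp only [if_true]
        rw [Finset.sum_eq_single i (fun k _ hk => by rw [if_neg hk, mul_zero]) (fun h => absurd (mem_univ i) h)]
        simp
      · rw [if_neg hij]
        refine Finset.sum_eq_zero fun k _ => ?_
        by_cases hki : k = i
        · subst hki
          rw [if_neg hij, mul_zero]
        · rw [if_neg hki, zero_mul]
  | succ n ih =>
      intro x hx i j
      have hx0 : K.depth x ≠ 0 := by omega
      have hp : K.depth (K.parent x) = n := by
        have := K.depth_parent x hx0
        omega
      simp_rw [K.tr_of_depth_ne_zero Rm hx0]
      calc ∑ k, (∑ a, K.tr Rm (K.parent x) k a * Rm (K.pbond x) a i) *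
              (∑ b, K.tr Rm (K.parent x) k b * Rm (K.pbond x) b j)
          = ∑ k, ∑ a, ∑ b, K.tr Rm (K.parent x) k a * Rm (K.pbond x) a i *
              (K.tr Rm (K.parent x) k b * Rm (K.pbond x) b j) := by
            refine Finset.sum_congr rfl fun k _ => ?_
            rw [Finset.sum_mul_sum]
        _ = ∑ a, ∑ b, Rm (K.pbond x) a i * Rm (K.pbond x) b j *
              ∑ k, K.tr Rm (K.parent x) k a * K.tr Rm (K.parent x) k b := by
            rw [Finset.sum_comm]
            refine Finset.sum_congr rfl fun a _ => ?_
            rw [Finset.sum_comm]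
            refine Finset.sum_congr rfl fun b _ => ?_
            rw [Finset.mul_sum]
            exact Finset.sum_congr rfl fun k _ => by ring
        _ = ∑ a, ∑ b, Rm (K.pbond x) a i * Rm (K.pbond x) b j * (if a = b then (1 : ℝ) else 0) := by
            refine Finset.sum_congr rfl fun a _ => Finset.sum_congr rfl fun b _ => ?_
            rw [ih _ hp a b]
        _ = ∑ a, Rm (K.pbond x) a i * Rm (K.pbond x) a j := by
            refine Finset.sum_congr rfl fun a _ => ?_
            rw [Finset.sum_eq_single a (fun b _ hb => by rw [if_neg (Ne.symm hb), mul_zero])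
              (fun h => absurd (mem_univ a) h)]
            simp
        _ = if i = j then (1 : ℝ) else 0 := hRm _ i j

/-- **Covariantly constant fields are reproduced by the transport**: if ∇_U f = 0 (`covD … f = 0`) and every bond
weight is non-zero, then (tr x)f(x) = f(base of the block of x) for every site x. [cite: Balaban1985BackgroundPropagators, (3.19) p.393 + (3.3) p.391] -/
theorem tr_reproduces {c : Bd → ℝ} (hc : ∀ b, c b ≠ 0) {f : St × Cp → ℝ} (hD : covD src tgt c Rm f = 0) :
    ∀ x i, ∑ j, K.tr Rm x i j * f (x, j) = f (K.base (K.blk x), i) := by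
  suffices h : ∀ n x, K.depth x = n → ∀ i, ∑ j, K.tr Rm x i j * f (x, j) = f (K.base (K.blk x), i) from
    fun x => h _ x rfl
  intro n
  induction n with
  | zero =>
      intro x hx i
      simp_rw [K.tr_of_depth_eq_zero Rm hx]
      rw [Finset.sum_eq_single i (fun j _ hj => by rw [if_neg (Ne.symm hj), zero_mul])
        (fun h => absurd (mem_univ i) h), if_pos rfl, one_mul, ← K.eq_base x hx]
  | succ n ih =>
      intro x hx i
      have hx0 : K.depth x ≠ 0 := by omega
      have hp : K.depth (K.parent x) = n := by
        have := K.depth_parent x hx0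
        omega
      have hcov : ∀ k, ∑ j, Rm (K.pbond x) k j * f (x, j) = f (K.parent x, k) := by
        intro k
        have h := congrFun hD (K.pbond x, k)
        rw [covD_apply, Pi.zero_apply, K.tgt_pbond x hx0, K.src_pbond x hx0] at h
        rcases mul_eq_zero.mp h with h0 | h0
        · exact absurd h0 (hc _)
        · exact sub_eq_zero.mp h0
      simp_rw [K.tr_of_depth_ne_zero Rm hx0]
      calc ∑ j, (∑ k, K.tr Rm (K.parent x) i k * Rm (K.pbond x) k j) * f (x, j)
          = ∑ k, K.tr Rm (K.parent x) i k * ∑ j, Rm (K.pbond x) k j * f (x, j) := by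
            simp_rw [Finset.sum_mul, Finset.mul_sum]
            rw [Finset.sum_comm]
            exact Finset.sum_congr rfl fun k _ => Finset.sum_congr rfl fun j _ => by ring
        _ = ∑ k, K.tr Rm (K.parent x) i k * f (K.parent x, k) := by simp_rw [hcov]
        _ = f (K.base (K.blk (K.parent x)), i) := ih _ hp i
        _ = f (K.base (K.blk x), i) := by rw [K.blk_parent x hx0]

/-- The transported field vanishes only where the field does (isometry). [folklore] -/
theorem eq_zero_of_tr_apply_eq_zero (hRm : ∀ b i j, ∑ k, Rm b k i * Rm b k j = if i = j then (1 : ℝ) else 0)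
    (x : St) (v : Cp → ℝ) (hv : ∀ i, ∑ j, K.tr Rm x i j * v j = 0) : v = 0 := by
  funext j'
  have horth := K.tr_orth Rm hRm x
  calc v j' = ∑ j, (if j' = j then (1 : ℝ) else 0) * v j := by
          rw [Finset.sum_eq_single j' (fun j _ hj => by rw [if_neg (Ne.symm hj), zero_mul])
            (fun h => absurd (mem_univ j') h), if_pos rfl, one_mul]
    _ = ∑ j, (∑ i, K.tr Rm x i j' * K.tr Rm x i j) * v j := by simp_rw [horth]
    _ = ∑ i, K.tr Rm x i j' * ∑ j, K.tr Rm x i j * v j := by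
          simp_rw [Finset.sum_mul, Finset.mul_sum]
          rw [Finset.sum_comm]
          exact Finset.sum_congr rfl fun i _ => Finset.sum_congr rfl fun j _ => by ring
    _ = 0 := by simp_rw [hv, mul_zero, Finset.sum_const_zero]
    _ = (0 : Cp → ℝ) j' := rfl

end Comb

/-! ## §2  The covariant block mean Q_U, its transpose, and the strict positivity of Δ_U + a·Q_UᵀQ_U -/

section Operators

variable {St Bd B Cp : Type}

/-- MODEL bookkeeping: the pointwise transport operator (T_P f)(x, i) = Σ_j P(x)_{ij} f(x, j). [folklore] -/
def trOp [Fintype Cp] (P : St → Cp → Cp → ℝ) : Module.End ℝ (St × Cp → ℝ) where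
  toFun f := fun p => ∑ j, P p.1 p.2 j * f (p.1, j)
  map_add' f f' := by
    funext p
    simp only [Pi.add_apply, mul_add, Finset.sum_add_distrib]
  map_smul' r f := by
    funext p
    simp only [Pi.smul_apply, smul_eq_mul, RingHom.id_apply, Finset.mul_sum]
    exact Finset.sum_congr rfl fun j _ => by ring

/-- Unfolding of `trOp`. [folklore] -/
@[simp] theorem trOp_apply [Fintype Cp] (P : St → Cp → Cp → ℝ) (f : St × Cp → ℝ) (p : St × Cp) :
    trOp P f p = ∑ j, P p.1 p.2 j * f (p.1, j) := rfl

/-- MODEL bookkeeping: the pointwise transposed transport (T_Pᵀ g)(x, j) = Σ_i P(x)_{ij} g(x, i). [folklore] -/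
def trOpT [Fintype Cp] (P : St → Cp → Cp → ℝ) : Module.End ℝ (St × Cp → ℝ) where
  toFun g := fun p => ∑ i, P p.1 i p.2 * g (p.1, i)
  map_add' g g' := by
    funext p
    simp only [Pi.add_apply, mul_add, Finset.sum_add_distrib]
  map_smul' r g := by
    funext p
    simp only [Pi.smul_apply, smul_eq_mul, RingHom.id_apply, Finset.mul_sum]
    exact Finset.sum_congr rfl fun i _ => by ring

/-- Unfolding of `trOpT`. [folklore] -/
@[simp] theorem trOpT_apply [Fintype Cp] (P : St → Cp → Cp → ℝ) (g : St × Cp → ℝ) (p : St × Cp) :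
    trOpT P g p = ∑ i, P p.1 i p.2 * g (p.1, i) := rfl

/-- `trOpT P` is the transpose of `trOp P` for the component pairing. [folklore] -/
theorem isTransposePair_trOp [Fintype St] [Fintype Cp] (P : St → Cp → Cp → ℝ) :
    IsTransposePair (trOp P) (trOpT P) := by
  intro f g
  rw [Fintype.sum_prod_type, Fintype.sum_prod_type]
  refine Finset.sum_congr rfl fun x _ => ?_
  calc ∑ i, trOp P f (x, i) * g (x, i) = ∑ i, ∑ j, P x i j * f (x, j) * g (x, i) := by
        refine Finset.sum_congr rfl fun i _ => ?_
        rw [trOp_apply, Finset.sum_mul]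
    _ = ∑ j, ∑ i, P x i j * f (x, j) * g (x, i) := Finset.sum_comm
    _ = ∑ j, f (x, j) * trOpT P g (x, j) := by
        refine Finset.sum_congr rfl fun j _ => ?_
        rw [trOpT_apply, Finset.mul_sum]
        exact Finset.sum_congr rfl fun i _ => by ring

/-- MODEL bookkeeping: the weighted block sum (S g)(β, i) = w(β)·Σ_{x : blk x = β} g(x, i) — with w(β) = L^{−d} and
no transport this is the plain block mean. [folklore] -/
def bsum [Fintype St] [DecidableEq B] (blk : St → B) (w : B → ℝ) : (St × Cp → ℝ) →ₗ[ℝ] (B × Cp → ℝ) where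
  toFun g := fun q => w q.1 * ∑ x, if blk x = q.1 then g (x, q.2) else 0
  map_add' g g' := by
    funext q
    simp only [Pi.add_apply]
    rw [← mul_add, ← Finset.sum_add_distrib]
    congr 1
    exact Finset.sum_congr rfl fun x _ => by split_ifs <;> simp
  map_smul' r g := by
    funext q
    simp only [Pi.smul_apply, smul_eq_mul, RingHom.id_apply]
    rw [Finset.mul_sum, Finset.mul_sum, Finset.mul_sum]
    exact Finset.sum_congr rfl fun x _ => by split_ifs <;> ring

/-- Unfolding of `bsum`. [folklore] -/
@[simp] theorem bsum_apply [Fintype St] [DecidableEq B] (blk : St → B) (w : B → ℝ) (g : St × Cp → ℝ)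
    (q : B × Cp) : bsum blk w g q = w q.1 * ∑ x, if blk x = q.1 then g (x, q.2) else 0 := rfl

/-- MODEL bookkeeping: the transposed block sum (Sᵀ h)(x, i) = w(blk x)·h(blk x, i). [folklore] -/
def bsumT (blk : St → B) (w : B → ℝ) : (B × Cp → ℝ) →ₗ[ℝ] (St × Cp → ℝ) where
  toFun h := fun p => w (blk p.1) * h (blk p.1, p.2)
  map_add' h h' := by
    funext p
    simp only [Pi.add_apply, mul_add]
  map_smul' r h := by
    funext p
    simp only [Pi.smul_apply, smul_eq_mul, RingHom.id_apply]
    ring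

/-- Unfolding of `bsumT`. [folklore] -/
@[simp] theorem bsumT_apply (blk : St → B) (w : B → ℝ) (h : B × Cp → ℝ) (p : St × Cp) :
    bsumT blk w h p = w (blk p.1) * h (blk p.1, p.2) := rfl

/-- `bsumT` is the transpose of `bsum` for the component pairings on `B × Cp` and `St × Cp`. [folklore] -/
theorem isTransposePair_bsum [Fintype St] [Fintype B] [DecidableEq B] [Fintype Cp] (blk : St → B) (w : B → ℝ) :
    IsTransposePair (bsum blk w (Cp := Cp)) (bsumT blk w) := by
  intro g h
  rw [Fintype.sum_prod_type, Fintype.sum_prod_type]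
  symm
  calc ∑ x, ∑ i, g (x, i) * bsumT blk w h (x, i)
      = ∑ x, ∑ β, if blk x = β then ∑ i, g (x, i) * (w β * h (β, i)) else 0 := by
        refine Finset.sum_congr rfl fun x _ => ?_
        rw [Finset.sum_ite_eq univ (blk x) (fun β => ∑ i, g (x, i) * (w β * h (β, i))), if_pos (mem_univ _)]
        rfl
    _ = ∑ β, ∑ x, if blk x = β then ∑ i, g (x, i) * (w β * h (β, i)) else 0 := Finset.sum_comm
    _ = ∑ β, ∑ i, bsum blk w g (β, i) * h (β, i) := by
        refine Finset.sum_congr rfl fun β _ => ?_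
        calc ∑ x, (if blk x = β then ∑ i, g (x, i) * (w β * h (β, i)) else 0)
            = ∑ x, ∑ i, (if blk x = β then g (x, i) else 0) * (w β * h (β, i)) := by
              refine Finset.sum_congr rfl fun x _ => ?_
              split_ifs
              · rfl
              · simp
          _ = ∑ i, ∑ x, (if blk x = β then g (x, i) else 0) * (w β * h (β, i)) := Finset.sum_comm
          _ = ∑ i, bsum blk w g (β, i) * h (β, i) := by
              refine Finset.sum_congr rfl fun i _ => ?_
              rw [bsum_apply, ← Finset.sum_mul]
              ring

variable {src tgt : Bd → St} (K : Comb src tgt B) (c : Bd → ℝ) (w : B → ℝ) (Rm : Bd → Cp → Cp → ℝ)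

/-- **The covariant block mean Q_U** (MODEL of the one-step averaging operator Q′(V) of (3.18)–(3.19), with
L^{−d} ↦ the block weight w(β)): (Q_U f)(β, i) = w(β)·Σ_{x : blk x = β} Σ_j (tr x)_{ij} f(x, j) — transport to the
base point, then sum over the block. [cite: Balaban1985BackgroundPropagators, (3.19) p.393] -/
def covMean [Fintype St] [DecidableEq B] [Fintype Cp] [DecidableEq Cp] : (St × Cp → ℝ) →ₗ[ℝ] (B × Cp → ℝ) :=
  bsum K.blk w ∘ₗ trOp (K.tr Rm)

/-- MODEL: the explicit transpose Q_Uᵀ of the covariant block mean. [cite: Balaban1985BackgroundPropagators, (3.19) p.393 + p.391] -/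
def covMeanT [Fintype Cp] [DecidableEq Cp] : (B × Cp → ℝ) →ₗ[ℝ] (St × Cp → ℝ) :=
  trOpT (K.tr Rm) ∘ₗ bsumT K.blk w

/-- Unfolding of `covMean`. [folklore] -/
theorem covMean_apply [Fintype St] [DecidableEq B] [Fintype Cp] [DecidableEq Cp] (f : St × Cp → ℝ) (q : B × Cp) :
    covMean K w Rm f q = w q.1 * ∑ x, if K.blk x = q.1 then ∑ j, K.tr Rm x q.2 j * f (x, j) else 0 := rfl

/-- Unfolding of `covMeanT`. [folklore] -/
theorem covMeanT_apply [Fintype Cp] [DecidableEq Cp] (h : B × Cp → ℝ) (p : St × Cp) :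
    covMeanT K w Rm h p = ∑ i, K.tr Rm p.1 i p.2 * (w (K.blk p.1) * h (K.blk p.1, i)) := rfl

/-- **Q_Uᵀ is the transpose of Q_U** for the component pairings (the L² adjoint of p. 391 in the model).
[cite: Balaban1985BackgroundPropagators, (3.19) p.393 + p.391] -/
theorem isTransposePair_covMean [Fintype St] [Fintype B] [DecidableEq B] [Fintype Cp] [DecidableEq Cp] :
    IsTransposePair (covMean K w Rm) (covMeanT K w Rm) :=
  (isTransposePair_trOp (K.tr Rm)).comp (isTransposePair_bsum K.blk w)

/-- **The one-step model of Δ′_a = Δ_U + Q′\*aQ′** ((3.23)–(3.24)): `covLapCov K c w Rm a = D\*D + a·Q_UᵀQ_U` with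
D = `covD`, D\* = `covDT` of `B9Thm37Glue` and the covariant block mean Q_U. [cite: Balaban1985BackgroundPropagators, (3.23)–(3.24) p.394 + (3.19) p.393] -/
def covLapCov [Fintype St] [DecidableEq St] [Fintype Bd] [DecidableEq B] [Fintype Cp] [DecidableEq Cp] (a : ℝ) :
    Module.End ℝ (St × Cp → ℝ) :=
  covDT src tgt c Rm ∘ₗ covD src tgt c Rm + a • (covMeanT K w Rm ∘ₗ covMean K w Rm)

/-- (aA)ᵗ = aAᵗ. [folklore] -/
theorem isTransposePair_smul {X Y : Type} [Fintype X] [Fintype Y] {A : (X → ℝ) →ₗ[ℝ] (Y → ℝ)}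
    {A' : (Y → ℝ) →ₗ[ℝ] (X → ℝ)} (h : IsTransposePair A A') (a : ℝ) : IsTransposePair (a • A) (a • A') := by
  intro u v
  calc ∑ y, (a • A) u y * v y = a * ∑ y, A u y * v y := by
        rw [Finset.mul_sum]
        exact Finset.sum_congr rfl fun y _ => by
          rw [LinearMap.smul_apply, Pi.smul_apply, smul_eq_mul]; ring
    _ = a * ∑ x, u x * A' v x := by rw [h u v]
    _ = ∑ x, u x * (a • A') v x := by
        rw [Finset.mul_sum]
        exact Finset.sum_congr rfl fun x _ => by
          rw [LinearMap.smul_apply, Pi.smul_apply, smul_eq_mul]; ring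

variable [Fintype St] [DecidableEq B] [Fintype Cp] [DecidableEq Cp]

/-- **On a covariantly constant field the covariant mean reads off the base-point values**:
(Q_U f)(β, i) = w(β)·#{x : blk x = β}·f(base β, i) when ∇_U f = 0 and all c(b) ≠ 0. [folklore] -/
theorem covMean_apply_of_covD_eq_zero (hc : ∀ b, c b ≠ 0) {f : St × Cp → ℝ} (hD : covD src tgt c Rm f = 0)
    (β : B) (i : Cp) :
    covMean K w Rm f (β, i) = w β * (((univ.filter fun x => K.blk x = β).card : ℝ) * f (K.base β, i)) := by
  rw [covMean_apply, ← Finset.sum_filter]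
  congr 1
  rw [Finset.sum_congr rfl fun x hx => show ∑ j, K.tr Rm x i j * f (x, j) = f (K.base β, i) by
      rw [K.tr_reproduces Rm hc hD x i, (mem_filter.mp hx).2],
    Finset.sum_const, nsmul_eq_mul]

/-- **THE MECHANISM.** A non-zero covariantly constant field (∇_U f = 0, all bond weights ≠ 0, isometric bond
matrices) has NON-ZERO covariant block mean (all block weights ≠ 0): it is reproduced from its base-point value,
which cannot vanish. (Contrast: the U-independent mean of `B9Thm37GlueTorusTwist` kills such a field.) [folklore] -/
theorem covMean_ne_zero (hRm : ∀ b i j, ∑ k, Rm b k i * Rm b k j = if i = j then (1 : ℝ) else 0)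
    (hc : ∀ b, c b ≠ 0) (hw : ∀ β, w β ≠ 0) {f : St × Cp → ℝ} (hf : f ≠ 0)
    (hD : covD src tgt c Rm f = 0) : covMean K w Rm f ≠ 0 := by
  obtain ⟨⟨x₀, i₁⟩, hx₀⟩ := Function.ne_iff.mp hf
  have hrep := K.tr_reproduces Rm hc hD
  have hv : ∃ i₀, f (K.base (K.blk x₀), i₀) ≠ 0 := by
    by_contra hall
    simp only [not_exists, not_not] at hall
    have hzero := K.eq_zero_of_tr_apply_eq_zero Rm hRm x₀ (fun j => f (x₀, j))
      (fun i => by rw [hrep x₀ i]; exact hall i)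
    exact hx₀ (by simpa using congrFun hzero i₁)
  obtain ⟨i₀, hi₀⟩ := hv
  intro hQ
  have h := congrFun hQ (K.blk x₀, i₀)
  rw [covMean_apply_of_covD_eq_zero K c w Rm hc hD, Pi.zero_apply] at h
  have hcard : 0 < (univ.filter fun x => K.blk x = K.blk x₀).card :=
    Finset.card_pos.mpr ⟨x₀, mem_filter.mpr ⟨mem_univ _, rfl⟩⟩
  have hcard' : ((univ.filter fun x => K.blk x = K.blk x₀).card : ℝ) ≠ 0 := by exact_mod_cast hcard.ne'
  exact mul_ne_zero (hw _) (mul_ne_zero hcard' hi₀) h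

variable [DecidableEq St] [Fintype Bd] [Fintype B]

/-- **Δ_U + a·Q_UᵀQ_U is symmetric** for the component pairing. [cite: Balaban1985BackgroundPropagators, (3.23)–(3.24) p.394 + p.391] -/
theorem isTransposePair_covLapCov (a : ℝ) : IsTransposePair (covLapCov K c w Rm a) (covLapCov K c w Rm a) :=
  (isTransposePair_covLap src tgt c Rm).add
    (isTransposePair_smul ((isTransposePair_covMean K w Rm).comp (isTransposePair_covMean K w Rm).symm) a)

/-- **The quadratic form of Δ_U + a·Q_UᵀQ_U**: Σ_p f(p)((D\*D + a·Q_UᵀQ_U)f)(p) = Σ_b (Df)(b)² + a·Σ_q (Q_U f)(q)² —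
the one-step model of (3.23)–(3.24). [cite: Balaban1985BackgroundPropagators, (3.23)–(3.24) p.394] -/
theorem qform_covLapCov (a : ℝ) (f : St × Cp → ℝ) :
    ∑ p, f p * covLapCov K c w Rm a f p =
      ∑ b, covD src tgt c Rm f b * covD src tgt c Rm f b +
        a * ∑ q, covMean K w Rm f q * covMean K w Rm f q := by
  rw [isTransposePair_covD src tgt c Rm f (covD src tgt c Rm f),
    isTransposePair_covMean K w Rm f (covMean K w Rm f), Finset.mul_sum, ← Finset.sum_add_distrib]
  refine Finset.sum_congr rfl fun p _ => ?_
  simp only [covLapCov, LinearMap.add_apply, Pi.add_apply, LinearMap.comp_apply, LinearMap.smul_apply,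
    Pi.smul_apply, smul_eq_mul]
  ring

/-- **MAIN THEOREM (MODEL). Δ_U + a·Q_UᵀQ_U is STRICTLY POSITIVE for EVERY transport**: for a > 0, non-zero block
weights, non-zero bond weights and isometric bond matrices, Σ_p f(p)((Δ_U + a·Q_UᵀQ_U)f)(p) > 0 for f ≠ 0 — no
flatness or small-curvature hypothesis on U (the model of p. 395 *"… the operator Δ′_a is positive"* with the
COVARIANT one-step mean; compare `B9Thm37GlueTorusInv.posDef_covLap_add_mulOp` for the massive stand-in and
`B9Thm37GlueTorusTwist.not_isUnit_twist` for the U-independent one). [cite: Balaban1985BackgroundPropagators, p.395 + (3.23)–(3.24) p.394 + (3.19) p.393] -/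
theorem posDef_covLapCov (hRm : ∀ b i j, ∑ k, Rm b k i * Rm b k j = if i = j then (1 : ℝ) else 0)
    (hc : ∀ b, c b ≠ 0) (hw : ∀ β, w β ≠ 0) {a : ℝ} (ha : 0 < a) (f : St × Cp → ℝ) (hf : f ≠ 0) :
    0 < ∑ p, f p * covLapCov K c w Rm a f p := by
  rw [qform_covLapCov]
  by_cases hD : covD src tgt c Rm f = 0
  · obtain ⟨q₀, hq₀⟩ := Function.ne_iff.mp (covMean_ne_zero K c w Rm hRm hc hw hf hD)
    rw [hD]
    simp only [Pi.zero_apply, mul_zero, Finset.sum_const_zero, zero_add]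
    exact mul_pos ha (lt_of_lt_of_le (mul_self_pos.mpr hq₀)
      (Finset.single_le_sum (f := fun q => covMean K w Rm f q * covMean K w Rm f q)
        (fun q _ => mul_self_nonneg _) (mem_univ q₀)))
  · obtain ⟨b₀, hb₀⟩ := Function.ne_iff.mp hD
    exact add_pos_of_pos_of_nonneg
      (lt_of_lt_of_le (mul_self_pos.mpr hb₀)
        (Finset.single_le_sum (f := fun b => covD src tgt c Rm f b * covD src tgt c Rm f b)
          (fun b _ => mul_self_nonneg _) (mem_univ b₀)))
      (mul_nonneg ha.le (Finset.sum_nonneg fun q _ => mul_self_nonneg _))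

/-- **Hence Δ_U + a·Q_UᵀQ_U is a unit** for every transport (finite dimension). [folklore] -/
theorem isUnit_covLapCov (hRm : ∀ b i j, ∑ k, Rm b k i * Rm b k j = if i = j then (1 : ℝ) else 0)
    (hc : ∀ b, c b ≠ 0) (hw : ∀ β, w β ≠ 0) {a : ℝ} (ha : 0 < a) : IsUnit (covLapCov K c w Rm a) :=
  isUnit_of_posDef (posDef_covLapCov K c w Rm hRm hc hw ha)

/-- `Ring.inverse` of Δ_U + a·Q_UᵀQ_U is a genuine LEFT inverse (not a junk value). [folklore] -/
theorem inverse_mul_covLapCov (hRm : ∀ b i j, ∑ k, Rm b k i * Rm b k j = if i = j then (1 : ℝ) else 0)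
    (hc : ∀ b, c b ≠ 0) (hw : ∀ β, w β ≠ 0) {a : ℝ} (ha : 0 < a) :
    Ring.inverse (covLapCov K c w Rm a) * covLapCov K c w Rm a = 1 :=
  inverse_mul_of_posDef (posDef_covLapCov K c w Rm hRm hc hw ha)

/-- `Ring.inverse` of Δ_U + a·Q_UᵀQ_U is a genuine RIGHT inverse. [folklore] -/
theorem mul_inverse_covLapCov (hRm : ∀ b i j, ∑ k, Rm b k i * Rm b k j = if i = j then (1 : ℝ) else 0)
    (hc : ∀ b, c b ≠ 0) (hw : ∀ β, w β ≠ 0) {a : ℝ} (ha : 0 < a) :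
    covLapCov K c w Rm a * Ring.inverse (covLapCov K c w Rm a) = 1 :=
  mul_inverse_of_posDef (posDef_covLapCov K c w Rm hRm hc hw ha)

end Operators

/-! ## §3  CONSTRUCTION: the lexicographic comb of the torus `UT N` with cubic blocks of side M₀ ∣ N_i -/

section TorusComb

variable {d : ℕ} {N : Fin d → ℕ}

/-- The offset of the μ-th coordinate inside its block: x_μ mod M₀. [folklore] -/
def offs (M₀ : ℕ) (x : UT N) (μ : Fin d) : ℕ := (UT.toSite N x μ).val % M₀

/-- The comb depth of a torus point: the sum of its offsets (the ℓ¹ distance to the block corner). [folklore] -/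
def tdepth (M₀ : ℕ) (x : UT N) : ℕ := ∑ μ, offs M₀ x μ

/-- Positive depth means some offset is non-zero. [folklore] -/
theorem exists_offs_ne_zero {M₀ : ℕ} {x : UT N} (hx : tdepth M₀ x ≠ 0) : ∃ μ, offs M₀ x μ ≠ 0 := by
  by_contra h
  simp only [not_exists, not_not] at h
  exact hx (Finset.sum_eq_zero fun μ _ => h μ)

/-- Zero depth means every offset vanishes. [folklore] -/
theorem offs_eq_zero_of_tdepth {M₀ : ℕ} {x : UT N} (hx : tdepth M₀ x = 0) (μ : Fin d) : offs M₀ x μ = 0 := by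
  by_contra h
  have hpos : 0 < tdepth M₀ x :=
    lt_of_lt_of_le (Nat.pos_of_ne_zero h)
      (Finset.single_le_sum (f := offs M₀ x) (fun ν _ => Nat.zero_le _) (mem_univ μ))
  omega

section Axis

variable [NeZero d]

/-- The comb axis at x: the first coordinate axis with non-zero offset (axis 0 if there is none). [folklore] -/
def axis (M₀ : ℕ) (x : UT N) : Fin d :=
  if h : ∃ μ, offs M₀ x μ ≠ 0 then Fin.find (fun μ => offs M₀ x μ ≠ 0) h else 0

/-- At positive depth the comb axis has non-zero offset. [folklore] -/
theorem offs_axis_ne_zero {M₀ : ℕ} {x : UT N} (hx : tdepth M₀ x ≠ 0) : offs M₀ x (axis M₀ x) ≠ 0 := by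
  have h := exists_offs_ne_zero hx
  unfold axis
  rw [dif_pos h]
  exact Fin.find_spec h

end Axis

variable [∀ i, NeZero (N i)]

/-- The block label of a torus point: (⌊x_i/M₀⌋)_i, an index of the lineage's cube cover `Ctr N M₀` (well defined
for 1 ≤ M₀, M₀ ∣ N_i). [folklore] -/
def tblk {M₀ : ℕ} (hM : 1 ≤ M₀) (hdiv : ∀ i, M₀ ∣ N i) (x : UT N) : Ctr N M₀ := fun i =>
  ⟨(UT.toSite N x i).val / M₀, by
    obtain ⟨q, hq⟩ := hdiv i
    have hN : 1 ≤ N i := UT.one_le N i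
    have hq1 : 1 ≤ q := by
      rcases Nat.eq_zero_or_pos q with h0 | h0
      · rw [h0, mul_zero] at hq; omega
      · exact h0
    have hdivq : N i / M₀ = q := by rw [hq, Nat.mul_div_cancel_left q hM]
    have hnC : nC (N i) M₀ = q := by rw [B5TorusCover.nC_eq_div (hdivq ▸ hq1 : 1 ≤ N i / M₀), hdivq]
    rw [hnC, Nat.div_lt_iff_lt_mul hM, mul_comm]
    exact hq ▸ (UT.toSite N x i).isLt⟩

/-- The value of a block label coordinate. [folklore] -/
theorem tblk_val {M₀ : ℕ} (hM : 1 ≤ M₀) (hdiv : ∀ i, M₀ ∣ N i) (x : UT N) (i : Fin d) :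
    (tblk hM hdiv x i).val = (UT.toSite N x i).val / M₀ := rfl

/-- The coordinates of x − e_μ: unchanged off the axis μ. [folklore] -/
theorem toSite_dn_of_ne (x : UT N) {μ i : Fin d} (h : i ≠ μ) : UT.toSite N (dn x μ) i = UT.toSite N x i := by
  show Function.update (UT.toSite N x) μ (UT.toSite N x μ - 1) i = _
  rw [Function.update_of_ne h]

/-- The μ-th coordinate of x − e_μ is x_μ − 1 (as a natural number) when x_μ ≠ 0. [folklore] -/
theorem toSite_dn_self_val (x : UT N) (μ : Fin d) (h : (UT.toSite N x μ).val ≠ 0) :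
    (UT.toSite N (dn x μ) μ).val = (UT.toSite N x μ).val - 1 := by
  have e : UT.toSite N (dn x μ) μ = UT.toSite N x μ - 1 := by
    show Function.update (UT.toSite N x) μ (UT.toSite N x μ - 1) μ = _
    rw [Function.update_self]
  rw [e]
  have hn : 2 ≤ N μ := by have := (UT.toSite N x μ).isLt; omega
  have h1 : ((1 : Fin (N μ)) : ℕ) = 1 := by
    rw [Fin.val_one']
    exact Nat.mod_eq_of_lt (by omega)
  have hle : (1 : Fin (N μ)) ≤ UT.toSite N x μ := by
    rw [Fin.le_def, h1]
    omega
  rw [Fin.coe_sub_iff_le.mpr hle, h1]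

variable [NeZero d]

/-- Offsets and block labels of x − e_μ along the comb axis μ: the offset drops by one, the block label is
unchanged. [folklore] -/
theorem offs_dn_axis {M₀ : ℕ} (hM : 1 ≤ M₀) {x : UT N} (hx : tdepth M₀ x ≠ 0) :
    offs M₀ (dn x (axis M₀ x)) (axis M₀ x) + 1 = offs M₀ x (axis M₀ x) ∧
      (UT.toSite N (dn x (axis M₀ x)) (axis M₀ x)).val / M₀ = (UT.toSite N x (axis M₀ x)).val / M₀ := by
  have hoff := offs_axis_ne_zero hx
  have hv0 : (UT.toSite N x (axis M₀ x)).val ≠ 0 := by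
    intro h0
    apply hoff
    show (UT.toSite N x (axis M₀ x)).val % M₀ = 0
    rw [h0, Nat.zero_mod]
  have hdn := toSite_dn_self_val x (axis M₀ x) hv0
  have hoff' : (UT.toSite N x (axis M₀ x)).val % M₀ ≠ 0 := hoff
  unfold offs
  generalize (UT.toSite N x (axis M₀ x)).val = v at hdn hoff' ⊢
  have h1 := Nat.div_add_mod v M₀
  have hlt : v % M₀ < M₀ := Nat.mod_lt v hM
  have hr : 1 ≤ v % M₀ := Nat.one_le_iff_ne_zero.mpr hoff'
  have he : v - 1 = M₀ * (v / M₀) + (v % M₀ - 1) := by omega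
  refine ⟨?_, ?_⟩
  · rw [hdn, he, Nat.mul_add_mod, Nat.mod_eq_of_lt (show v % M₀ - 1 < M₀ by omega)]
    omega
  · rw [hdn, he, Nat.mul_add_div hM, Nat.div_eq_of_lt (show v % M₀ - 1 < M₀ by omega), add_zero]

/-- The depth of x − e_μ along the comb axis is one less. [folklore] -/
theorem tdepth_dn_axis {M₀ : ℕ} (hM : 1 ≤ M₀) {x : UT N} (hx : tdepth M₀ x ≠ 0) :
    tdepth M₀ (dn x (axis M₀ x)) + 1 = tdepth M₀ x := by
  have hoff := (offs_dn_axis hM hx).1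
  have hA : offs M₀ x (axis M₀ x) + (univ.erase (axis M₀ x)).sum (offs M₀ x) = tdepth M₀ x :=
    Finset.add_sum_erase univ (offs M₀ x) (mem_univ _)
  have hB : offs M₀ (dn x (axis M₀ x)) (axis M₀ x) + (univ.erase (axis M₀ x)).sum (offs M₀ (dn x (axis M₀ x))) =
      tdepth M₀ (dn x (axis M₀ x)) :=
    Finset.add_sum_erase univ (offs M₀ (dn x (axis M₀ x))) (mem_univ _)
  have hS : (univ.erase (axis M₀ x)).sum (offs M₀ (dn x (axis M₀ x))) = (univ.erase (axis M₀ x)).sum (offs M₀ x) :=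
    Finset.sum_congr rfl fun μ hμ => by
      show (UT.toSite N (dn x (axis M₀ x)) μ).val % M₀ = (UT.toSite N x μ).val % M₀
      rw [toSite_dn_of_ne x (Finset.ne_of_mem_erase hμ)]
  rw [hS] at hB
  omega

/-- **CONSTRUCTION: the lexicographic comb of the torus with cubic blocks of side M₀** (1 ≤ M₀, M₀ ∣ N_i): blocks
labelled by the cube cover `Ctr N M₀`, base points the block corners M₀z (`ctrU`), parent of x = x − e_μ along the
first axis μ with non-zero offset, parent bond the nearest-neighbour bond (x − e_μ, μ) of `B9Thm37GluePU`
(`bsrc` = x − e_μ, `btgt` = x). [folklore] -/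
def torusComb {M₀ : ℕ} (hM : 1 ≤ M₀) (hdiv : ∀ i, M₀ ∣ N i) :
    Comb (bsrc (N := N)) (btgt (N := N)) (Ctr N M₀) where
  blk := tblk hM hdiv
  base := ctrU N M₀
  depth := tdepth M₀
  parent x := dn x (axis M₀ x)
  pbond x := (dn x (axis M₀ x), axis M₀ x)
  eq_base x hx := by
    funext i
    apply Fin.ext
    show (UT.toSite N x i).val = M₀ * ((UT.toSite N x i).val / M₀)
    have h1 := Nat.div_add_mod (UT.toSite N x i).val M₀
    have h2 : (UT.toSite N x i).val % M₀ = 0 := offs_eq_zero_of_tdepth hx i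
    omega
  src_pbond x hx := rfl
  tgt_pbond x hx := up_dn x (axis M₀ x)
  depth_parent x hx := tdepth_dn_axis hM hx
  blk_parent x hx := by
    funext i
    apply Fin.ext
    rw [tblk_val, tblk_val]
    by_cases hi : i = axis M₀ x
    · rw [hi]
      exact (offs_dn_axis hM hx).2
    · rw [toSite_dn_of_ne x hi]

/-- The block labels of the torus comb, unfolded. [folklore] -/
theorem torusComb_blk {M₀ : ℕ} (hM : 1 ≤ M₀) (hdiv : ∀ i, M₀ ∣ N i) (x : UT N) :
    (torusComb hM hdiv).blk x = tblk hM hdiv x := rfl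

/-- The base points of the torus comb are the block corners `ctrU`. [folklore] -/
theorem torusComb_base {M₀ : ℕ} (hM : 1 ≤ M₀) (hdiv : ∀ i, M₀ ∣ N i) (z : Ctr N M₀) :
    (torusComb hM hdiv).base z = ctrU N M₀ z := rfl

/-- **Δ_U + a·Q_UᵀQ_U on the torus with cubic blocks is a unit for EVERY isometric transport**, all bond weights
≠ 0, block weights ≠ 0, a > 0 (the standing regime 1 ≤ M₀, M₀ ∣ N_i of the chain). [folklore] -/
theorem isUnit_covLapCov_torus {Cp : Type} [Fintype Cp] [DecidableEq Cp] {M₀ : ℕ} (hM : 1 ≤ M₀)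
    (hdiv : ∀ i, M₀ ∣ N i) (c : UT N × Fin d → ℝ) (hc : ∀ b, c b ≠ 0) (w : Ctr N M₀ → ℝ) (hw : ∀ z, w z ≠ 0)
    (Rm : UT N × Fin d → Cp → Cp → ℝ) (hRm : ∀ b i j, ∑ k, Rm b k i * Rm b k j = if i = j then (1 : ℝ) else 0)
    {a : ℝ} (ha : 0 < a) : IsUnit (covLapCov (torusComb hM hdiv) c w Rm a) :=
  isUnit_covLapCov _ c w Rm hRm hc hw ha

end TorusComb

/-! ## §4  The twist revisited: the covariant mean does NOT kill the twist fields, and Δ_U + a·Q_UᵀQ_U is a unit -/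

section TwistRevisited

/-- The circle regime: 1 ≤ 4 and 4 ∣ 4. [folklore] -/
theorem hyps_N4 : (1 : ℕ) ≤ 4 ∧ ∀ i : Fin 1, 4 ∣ N4 i := ⟨by norm_num, fun _ => dvd_rfl⟩

/-- MODEL: the one-block comb of the 4-point circle (block side 4). [folklore] -/
def comb4 : Comb (bsrc (N := N4)) (btgt (N := N4)) (Ctr N4 4) := torusComb hyps_N4.1 hyps_N4.2

/-- **The twist field has non-zero COVARIANT mean** (every block weight ≠ 0) — whereas its U-independent mean
vanishes (`B9Thm37GlueTorusTwist.meanOp_fw`). [folklore] -/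
theorem covMean_fw_ne_zero (w : Ctr N4 4 → ℝ) (hw : ∀ z, w z ≠ 0) : covMean comb4 w Rm4 fw ≠ 0 :=
  covMean_ne_zero comb4 (fun _ => (1 : ℝ)) w Rm4 hRm_Rm4 (fun _ => one_ne_zero) hw fw_ne_zero
    (covD_fw fun _ => 1)

/-- **CONTRAST with `not_isUnit_twist`**: for the same flat quarter-turn transport on the 4-point circle,
Δ_U + a·Q_UᵀQ_U with the COVARIANT block mean is a unit (all c(b) ≠ 0, w ≠ 0, a > 0). [folklore] -/
theorem isUnit_cov_twist (c : UT N4 × Fin 1 → ℝ) (hc : ∀ b, c b ≠ 0) (w : Ctr N4 4 → ℝ) (hw : ∀ z, w z ≠ 0)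
    {a : ℝ} (ha : 0 < a) : IsUnit (covLapCov comb4 c w Rm4 a) :=
  isUnit_covLapCov comb4 c w Rm4 hRm_Rm4 hc hw ha

/-- MODEL: the two-block comb of the 8-point circle (block side M₀ = 4, inside the torus regime of the chain,
`B9Thm37GlueTorusTwist.lineage_hyps_N8`). [folklore] -/
def comb8 : Comb (bsrc (N := N8)) (btgt (N := N8)) (Ctr N8 4) :=
  torusComb lineage_hyps_N8.1 lineage_hyps_N8.2.1

/-- **The two-block twist field has non-zero COVARIANT block mean** — whereas its U-independent block mean vanishes
(`B9Thm37GlueTorusTwist.blockMean_fw8`). [folklore] -/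
theorem covMean_fw8_ne_zero (w : Ctr N8 4 → ℝ) (hw : ∀ z, w z ≠ 0) : covMean comb8 w Rm8 fw8 ≠ 0 :=
  covMean_ne_zero comb8 (fun _ => (1 : ℝ)) w Rm8 hRm_Rm8 (fun _ => one_ne_zero) hw fw8_ne_zero
    (covD_fw8 fun _ => 1)

/-- **CONTRAST with `not_isUnit_twist8`**: on the 8-point circle with two blocks of side 4 and the flat quarter-turn
transport, Δ_U + a·Q_UᵀQ_U with the COVARIANT block mean is a unit (all c(b) ≠ 0, w ≠ 0, a > 0). [folklore] -/
theorem isUnit_cov_twist8 (c : UT N8 × Fin 1 → ℝ) (hc : ∀ b, c b ≠ 0) (w : Ctr N8 4 → ℝ) (hw : ∀ z, w z ≠ 0)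
    {a : ℝ} (ha : 0 < a) : IsUnit (covLapCov comb8 c w Rm8 a) :=
  isUnit_covLapCov comb8 c w Rm8 hRm_Rm8 hc hw ha

/-- The two stand-ins side by side on the 8-point circle (same Δ_U, same coupling a, all c(b) ≠ 0): the
U-independent block mean gives a NON-unit, the covariant block mean a unit. [folklore] -/
theorem twist8_contrast (c : UT N8 × Fin 1 → ℝ) (hc : ∀ b, c b ≠ 0) (w : Ctr N8 4 → ℝ) (hw : ∀ z, w z ≠ 0)
    {a : ℝ} (ha : 0 < a) :
    ¬ IsUnit (covDT bsrc btgt c Rm8 ∘ₗ covD bsrc btgt c Rm8 + a • blockMean) ∧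
      IsUnit (covDT bsrc btgt c Rm8 ∘ₗ covD bsrc btgt c Rm8 +
        a • (covMeanT comb8 w Rm8 ∘ₗ covMean comb8 w Rm8)) := by
  refine ⟨not_isUnit_twist8 c a, ?_⟩
  have h := isUnit_cov_twist8 c hc w hw ha
  unfold covLapCov at h
  exact h

end TwistRevisited

end

end Literature.MathematicalPhysics.QuantumFieldTheory.Balaban1983to89.B9Thm37GlueTorusCov
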